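import Summits.Ventures.CertifiedQuantumChemistry.Rows.APosterioriLowerBound
import Literature.MathematicalPhysics.QuantumChemistry.DualConeLowerBound
import HarnessLib

/-!
# Ventures/CertifiedQuantumChemistry — Rows/DualConeLowerRow.lean: a LOWER ROW from an ARBITRARY
# necessary condition set (LADDER-CHEM I-TYPE slot 07, row-level bridge)

HONEST FRAMING (verbatim, page 1 of every file of the cell): certified bounds for a stated model
Hamiltonian in a stated basis; not a claim about the real molecule or material beyond that model.

WHAT THIS FILE IS. The row-level composition of the generic Literature statement
`Literature/MathematicalPhysics/QuantumChemistry/DualConeLowerBound.lean` (Cancès–Stoltz–Lewin 2006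
§3: a relaxation by ANY finite set of necessary `N`-representability conditions bounds the exact
energy from below, `E_app ≤ E`; its dual-cone certificate `K_N − μ ∈ {Σ_ℓ (𝓛_ℓ)* B_ℓ, B_ℓ ⪰ 0}`)
with the venture's certified quantity `Model.energy F a b = E₀(H_F; N_α = a, N_β = b)` and row
predicate `LowerRow F a b lo` (`Statement.lean`):

* `lowerRow_of_forall_necessary` — for a symmetric model, `a, b ≤ k`, a condition `C` on pairs
  `(γ, Γ)` that is NECESSARY in the sector (`IsNecessaryInSector a b C`: every unit sector vector's RDM
  pair satisfies it — e.g. any conjunction of the topic's named conditions D, Q, G, T1, T2, T2′ with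
  its linear / sector rows) and a rational `lo` below the energy functional `Re E_F(γ, Γ)` on the
  `C`-feasible set: `LowerRow F a b lo`. The fixed-list rows of record (`IsDQGFeasibleSector`,
  `IsDQGT1T2PrimeFeasibleSector`) are instances; so is every future list, by its necessity lemma alone.
* `lowerRow_of_dualCone_certificate` — the SDP weak-duality certificate of CSL eqs. (8), (10) for an
  arbitrary finite family of positive maps `𝓛_c` (one positive semidefinite multiplier `B_c` per
  condition, free multipliers for necessary equality rows, the Lagrangian identity
  `E_F(γ, Γ) − μ = Σ_c tr(B_c 𝓛_c(γ, Γ)) + Σ_r λ_r (A_r(γ, Γ) − b_r)` for all pairs) proves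
  `LowerRow F a b lo` for every rational `lo ≤ μ`.
* `APosteriori.IsEncoding F a b C …` / `IsEncoding.isSectorRelaxation` / `lowerRow_of_isEncoding` —
  the RDM-level ENCODING PREDICATE of `Rows/APosterioriLowerBound.lean` (slot 08) for an ARBITRARY
  necessary condition set `C` in place of the fixed `IsDQGFeasibleSector` of `IsDQGEncoding` (whose
  docstring sends programmes "carrying FURTHER necessary conditions (T1, T2, T2′) on top of DQG" to the
  state-level predicate): a block programme encodes the `C`-relaxation of `F` if every `C`-feasible pair
  has a primal-feasible, trace-bounded image with objective `≤ Re E_F(γ, Γ)`; for necessary `C` this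
  is a state-level `IsSectorRelaxation` (one line: the sector state's RDM pair is `C`-feasible and its
  functional value is `⟨ψ, H_F ψ⟩`, `rdmEnergy_rdm`), hence the Jansson–Chaykin–Keil bridge
  `lowerRow_of_isSectorRelaxation` applies verbatim; `IsDQGEncoding` is the case
  `C = IsDQGFeasibleSector a b` (`IsDQGEncoding.isEncoding`).

Everything is PROVED (0 sorry, no claim node, no model instance, NO BOUND ASSERTED); one parametrised
predicate (`APosteriori.IsEncoding`, asserts nothing). Typer seat chem-type-07 (cell chem-oracle, I-TYPE
slot 07); never edits `Rows/SectorRows.lean` or `Rows/APosterioriLowerBound.lean` (sibling file).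

References: E. Cancès, G. Stoltz, M. Lewin, J. Chem. Phys. 125 (2006) 064101 = arXiv:quant-ph/0602042,
§3 eqs. (7)–(10) [corpus:paper:arxiv-quant-ph_0602042 p0005–p0006, opened 2026-08-26]
[CancesStoltzLewin2006]; M. Nakata et al., J. Chem. Phys. 128 (2008) 164113 §II.C–D [NakataEtAl2008];
D. A. Mazziotti, Adv. Chem. Phys. 134 (2007) ch. 3 §III eqs. (107)–(111) [Mazziotti2007RDMChapter];
C. Jansson, arXiv:0707.4366 (2007) Cor. 7.1 [Jansson2007] (through `Rows/APosterioriLowerBound.lean`).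
-/

namespace Summit.Ventures.CertifiedQuantumChemistry

open Matrix Finset
open Literature.MathematicalPhysics.QuantumLattice Literature.MathematicalPhysics.QuantumChemistry
open scoped ComplexOrder

variable {k : ℕ}

/-! ## Lower rows from an arbitrary necessary condition set -/

/-- **LOWER ROW FROM AN ARBITRARY NECESSARY CONDITION SET.** For a symmetric model `F`, a physical
sector `a, b ≤ k`, a condition `C` on pairs `(γ, Γ)` necessary in the sector `(a, b)` and a rational
`lo` lying below the energy functional of `F`'s exact-rational tables on every `C`-feasible pair:
`LowerRow F a b lo`. Cancès–Stoltz–Lewin (2006) §3, "since `𝒞_app ⊃ 𝒞_N`, the energy `E_app` is a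
lower bound to the full CI energy in the chosen basis" (tree: `le_sectorGroundEnergy_of_forall_necessary`).
[cite: CancesStoltzLewin2006, §3 eqs. (9)-(10)] -/
theorem lowerRow_of_forall_necessary {F : Model k} (hF : F.IsSymmetric) {a b : ℕ} (ha : a ≤ k)
    (hb : b ≤ k)
    {C : Matrix (Orb (Fin k)) (Orb (Fin k)) ℂ →
      Matrix (Orb (Fin k) × Orb (Fin k)) (Orb (Fin k) × Orb (Fin k)) ℂ → Prop}
    (hC : IsNecessaryInSector a b C) {lo : ℚ}
    (hlo : ∀ γ Γ, C γ Γ → ((lo : ℚ) : ℝ) ≤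
      (rdmEnergy (fun p q => (F.h p q : ℂ)) (fun p q r s => (F.eri p q r s : ℂ)) (F.ecore : ℂ)
        γ Γ).re) :
    LowerRow F a b lo :=
  ⟨ha, hb, le_sectorGroundEnergy_of_forall_necessary (Model.hamiltonian_isHermitian hF)
    (by simpa using ha) (by simpa using hb) hC hlo⟩

/-- The DQG rows of record are the instance `C = IsDQGFeasibleSector a b` (recovering the hypothesis
shape of `le_sectorGroundEnergy_of_forall_isDQGFeasibleSector`). [cite: Mazziotti2007RDMChapter, §II.B, §II.F] -/
theorem lowerRow_of_forall_isDQGFeasibleSector {F : Model k} (hF : F.IsSymmetric) {a b : ℕ}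
    (ha : a ≤ k) (hb : b ≤ k) {lo : ℚ}
    (hlo : ∀ γ Γ, IsDQGFeasibleSector a b γ Γ → ((lo : ℚ) : ℝ) ≤
      (rdmEnergy (fun p q => (F.h p q : ℂ)) (fun p q r s => (F.eri p q r s : ℂ)) (F.ecore : ℂ)
        γ Γ).re) :
    LowerRow F a b lo :=
  lowerRow_of_forall_necessary hF ha hb (isNecessaryInSector_isDQGFeasibleSector a b) hlo

/-- The DQGT1T2′ rows of record are the instance `C = IsDQGT1T2PrimeFeasibleSector a b`.
[cite: NakataEtAl2008, §II.C] -/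
theorem lowerRow_of_forall_isDQGT1T2PrimeFeasibleSector {F : Model k} (hF : F.IsSymmetric)
    {a b : ℕ} (ha : a ≤ k) (hb : b ≤ k) {lo : ℚ}
    (hlo : ∀ γ Γ, IsDQGT1T2PrimeFeasibleSector a b γ Γ → ((lo : ℚ) : ℝ) ≤
      (rdmEnergy (fun p q => (F.h p q : ℂ)) (fun p q r s => (F.eri p q r s : ℂ)) (F.ecore : ℂ)
        γ Γ).re) :
    LowerRow F a b lo :=
  lowerRow_of_forall_necessary hF ha hb (isNecessaryInSector_isDQGT1T2PrimeFeasibleSector a b) hlo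

/-! ## Lower rows from a dual-cone (SDP weak-duality) certificate with one multiplier per condition -/

section DualCone

variable {κ : Type*} [Fintype κ] {X : κ → Type*} [∀ c, Fintype (X c)] [∀ c, DecidableEq (X c)]

/-- **DUAL-CONE CERTIFICATE ⇒ LOWER ROW** (generic SDP weak-duality soundness, arbitrary finite
condition set). Symmetric model `F`, `a, b ≤ k`; a finite family of matrix-valued conditions `𝓛_c`
(block types `X c`) and of equality rows `A_r = b_r`, both NECESSARY in the sector `(a, b)`; positive
semidefinite multipliers `B_c`, free multipliers `λ_r`, a real `μ` and the Lagrangian identity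
`E_F(γ, Γ) − μ = Σ_c tr(B_c · 𝓛_c(γ, Γ)) + Σ_r λ_r (A_r(γ, Γ) − b_r)` for ALL pairs (for linear
`𝓛_c`: `K_N − μ ∈ (𝒞_app)* = {Σ_c (𝓛_c)* B_c | B_c ⪰ 0}`, Cancès–Stoltz–Lewin eqs. (8), (10)). Then
`LowerRow F a b lo` for every rational `lo ≤ μ` (tree: `le_sectorGroundEnergy_of_dualCone_certificate`).
[cite: CancesStoltzLewin2006, §3 eqs. (8)-(10)] -/
theorem lowerRow_of_dualCone_certificate {F : Model k} (hF : F.IsSymmetric) {a b : ℕ} (ha : a ≤ k)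
    (hb : b ≤ k)
    (L : ∀ c : κ, Matrix (Orb (Fin k)) (Orb (Fin k)) ℂ →
      Matrix (Orb (Fin k) × Orb (Fin k)) (Orb (Fin k) × Orb (Fin k)) ℂ → Matrix (X c) (X c) ℂ)
    (hL : IsNecessaryInSector a b (PosMapFeasible L)) {ρ : Type*} [Fintype ρ]
    (A : ρ → Matrix (Orb (Fin k)) (Orb (Fin k)) ℂ →
      Matrix (Orb (Fin k) × Orb (Fin k)) (Orb (Fin k) × Orb (Fin k)) ℂ → ℂ) (rhs : ρ → ℂ)
    (hArows : IsNecessaryInSector a b fun γ Γ => ∀ r, A r γ Γ = rhs r)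
    {B : ∀ c : κ, Matrix (X c) (X c) ℂ} (hB : ∀ c, (B c).PosSemidef) (lam : ρ → ℂ) {μ : ℝ}
    (hcert : ∀ γ Γ,
      rdmEnergy (fun p q => (F.h p q : ℂ)) (fun p q r s => (F.eri p q r s : ℂ)) (F.ecore : ℂ) γ Γ -
          (μ : ℂ) =
        ∑ c, (B c * L c γ Γ).trace + ∑ r, lam r * (A r γ Γ - rhs r))
    {lo : ℚ} (hlo : ((lo : ℚ) : ℝ) ≤ μ) : LowerRow F a b lo :=
  ⟨ha, hb, hlo.trans (le_sectorGroundEnergy_of_dualCone_certificate (Model.hamiltonian_isHermitian hF)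
    (by simpa using ha) (by simpa using hb) L hL A rhs hArows hB lam hcert)⟩

end DualCone

/-! ## The RDM-level encoding predicate of slot 08 for an arbitrary necessary condition set -/

namespace APosteriori

section Encoding

variable {ι : Type*} [Fintype ι] {σ : ι → Type*} [∀ j, Fintype (σ j)] [∀ j, DecidableEq (σ j)]
  {μ : Type*} [Fintype μ]

/-- **ENCODING PREDICATE AT THE 2-RDM LEVEL FOR AN ARBITRARY CONDITION SET.** The real block
programme `(C, A, rhs)` with trace bounds `τ` and constant `c₀` ENCODES the relaxation of the model `F`
by the condition `Cnd` on pairs `(γ, Γ)`: every `Cnd`-feasible pair has a primal-feasible image `X`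
(`X_j ⪰ 0`, `Σ_j ⟨A_ij, X_j⟩ = rhs_i`, `tr X_j ≤ τ_j`) with `c₀ + Σ_j ⟨C_j, X_j⟩ ≤ Re E_F(γ, Γ)`. With
`Cnd = IsDQGFeasibleSector a b` this is `IsDQGEncoding`; with `Cnd` a DQGT1T2′ (or any other) list it is
what a generator for that list implements. The predicate does not mention the sector: the sector
enters through the necessity of `Cnd` (`IsEncoding.isSectorRelaxation`). Printed instance: Mazziotti's
primal programme "minimize `⟨c|x⟩` such that `A|x⟩ = |b⟩`, `M(x) ≥ 0`"; CSL's `E_app` over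
`𝒞_app = {∀ ℓ, 𝓛_ℓ(Γ) ≥ 0}`. Asserts nothing. [cite: Mazziotti2007RDMChapter, Ch. 3 §III eqs. (107)-(110), p.54]
[cite: CancesStoltzLewin2006, §3 eqs. (7), (9)] -/
def IsEncoding (F : Model k)
    (Cnd : Matrix (Orb (Fin k)) (Orb (Fin k)) ℂ →
      Matrix (Orb (Fin k) × Orb (Fin k)) (Orb (Fin k) × Orb (Fin k)) ℂ → Prop)
    (C : ∀ j, Matrix (σ j) (σ j) ℝ) (A : μ → ∀ j, Matrix (σ j) (σ j) ℝ) (rhs : μ → ℝ) (τ : ι → ℝ)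
    (c₀ : ℝ) : Prop :=
  ∀ (γ : Matrix (Orb (Fin k)) (Orb (Fin k)) ℂ) (Γ : Matrix (Orb (Fin k) × Orb (Fin k))
      (Orb (Fin k) × Orb (Fin k)) ℂ), Cnd γ Γ →
    ∃ X : ∀ j, Matrix (σ j) (σ j) ℝ,
      (∀ j, (X j).PosSemidef) ∧ (∀ i, ∑ j, (A i j * X j).trace = rhs i) ∧
        (∀ j, (X j).trace ≤ τ j) ∧
        c₀ + ∑ j, (C j * X j).trace ≤
          (rdmEnergy (fun p q => (F.h p q : ℂ)) (fun p q r s => (F.eri p q r s : ℂ)) (F.ecore : ℂ)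
            γ Γ).re

omit [∀ j, DecidableEq (σ j)] [Fintype μ] in
/-- **An encoding of a NECESSARY condition set is a state-level sector relaxation**: if `Cnd` is
necessary in the sector `(a, b)` (`IsNecessaryInSector`), an `IsEncoding F Cnd …` programme satisfies
`IsSectorRelaxation F a b …` of `Rows/APosterioriLowerBound.lean` (the sector state's RDM pair is
`Cnd`-feasible and its functional value is `⟨ψ, H_F ψ⟩`, `rdmEnergy_rdm`) — so the Jansson–Chaykin–Keil
bridges there apply to programmes with ANY list of necessary conditions (T1, T2, T2′, …), the case the
docstring of `IsDQGEncoding` defers. Cancès–Stoltz–Lewin §3: "valid for any set of necessary conditions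
of the form (7)". [cite: CancesStoltzLewin2006, §3 eqs. (7), (9)-(10)] -/
theorem IsEncoding.isSectorRelaxation {F : Model k} {a b : ℕ}
    {Cnd : Matrix (Orb (Fin k)) (Orb (Fin k)) ℂ →
      Matrix (Orb (Fin k) × Orb (Fin k)) (Orb (Fin k) × Orb (Fin k)) ℂ → Prop}
    (hCnd : IsNecessaryInSector a b Cnd) {C : ∀ j, Matrix (σ j) (σ j) ℝ}
    {A : μ → ∀ j, Matrix (σ j) (σ j) ℝ} {rhs : μ → ℝ} {τ : ι → ℝ} {c₀ : ℝ}
    (h : IsEncoding F Cnd C A rhs τ c₀) : IsSectorRelaxation F a b C A rhs τ c₀ := by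
  intro ψ hψ hψ1
  obtain ⟨X, hX, hAX, hτ, hobj⟩ := h _ _ (hCnd ψ hψ hψ1)
  refine ⟨X, hX, hAX, hτ, ?_⟩
  rw [rdmEnergy_rdm _ _ _ hψ1] at hobj
  exact hobj

omit [∀ j, DecidableEq (σ j)] [Fintype μ] in
/-- `IsDQGEncoding` is the instance `Cnd = IsDQGFeasibleSector a b` of `IsEncoding` (definitional).
[cite: Mazziotti2007RDMChapter, Ch. 3 §III eqs. (107)-(110), p.54] -/
theorem isDQGEncoding_iff_isEncoding (F : Model k) (a b : ℕ) (C : ∀ j, Matrix (σ j) (σ j) ℝ)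
    (A : μ → ∀ j, Matrix (σ j) (σ j) ℝ) (rhs : μ → ℝ) (τ : ι → ℝ) (c₀ : ℝ) :
    IsDQGEncoding F a b C A rhs τ c₀ ↔ IsEncoding F (IsDQGFeasibleSector a b) C A rhs τ c₀ :=
  Iff.rfl

/-- **THE BRIDGE for an RDM-level encoding of an arbitrary necessary condition set**: `IsEncoding` of
a sector-necessary `Cnd` + ANY approximate dual vector `ỹ` + certified shifts `d_j` with
`C_j − Σ_i ỹ_i A_ij − d_j·1 ⪰ 0` ⇒ `LowerRow F a b lo` for every rational
`lo ≤ c₀ + rhsᵀỹ + Σ_j min(d_j, 0) · τ_j` (symmetric `F`, `a, b ≤ k`): Jansson's Cor. 7.1 (a) through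
`lowerRow_of_isSectorRelaxation`; with all `d_j ≥ 0` it is plain SDP weak duality for the arbitrary
condition list. [cite: Jansson2007, §7 Cor. 7.1 (a), p.14] [cite: CancesStoltzLewin2006, §3 eqs. (9)-(10)] -/
theorem lowerRow_of_isEncoding {F : Model k} (hF : F.IsSymmetric) {a b : ℕ} (ha : a ≤ k) (hb : b ≤ k)
    {Cnd : Matrix (Orb (Fin k)) (Orb (Fin k)) ℂ →
      Matrix (Orb (Fin k) × Orb (Fin k)) (Orb (Fin k) × Orb (Fin k)) ℂ → Prop}
    (hCnd : IsNecessaryInSector a b Cnd) {C : ∀ j, Matrix (σ j) (σ j) ℝ}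
    {A : μ → ∀ j, Matrix (σ j) (σ j) ℝ} {rhs : μ → ℝ} {τ : ι → ℝ} {c₀ : ℝ}
    (henc : IsEncoding F Cnd C A rhs τ c₀) (y : μ → ℝ) (d : ι → ℝ)
    (hD : ∀ j, (C j - ∑ i, y i • A i j - d j • (1 : Matrix (σ j) (σ j) ℝ)).PosSemidef) {lo : ℚ}
    (hlo : ((lo : ℚ) : ℝ) ≤ c₀ + ∑ i, rhs i * y i + ∑ j, min (d j) 0 * τ j) :
    LowerRow F a b lo :=
  lowerRow_of_isSectorRelaxation hF ha hb (henc.isSectorRelaxation hCnd) y d hD hlo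

omit [∀ j, DecidableEq (σ j)] [Fintype μ] in
/-- An encoding of a condition set `D` is an encoding of every STRONGER condition set `Cnd ⊆ D`
(fewer feasible pairs to map); in particular an encoding of the DQG list serves any list containing
DQG when only the DQG part is used for the bound ("obvious inclusion relations", Nakata et al. 2008
§II.C). [cite: NakataEtAl2008, §II.C] -/
theorem IsEncoding.of_imp {F : Model k}
    {Cnd D : Matrix (Orb (Fin k)) (Orb (Fin k)) ℂ →
      Matrix (Orb (Fin k) × Orb (Fin k)) (Orb (Fin k) × Orb (Fin k)) ℂ → Prop}
    {C : ∀ j, Matrix (σ j) (σ j) ℝ} {A : μ → ∀ j, Matrix (σ j) (σ j) ℝ} {rhs : μ → ℝ} {τ : ι → ℝ}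
    {c₀ : ℝ} (h : IsEncoding F D C A rhs τ c₀) (hCD : ∀ γ Γ, Cnd γ Γ → D γ Γ) :
    IsEncoding F Cnd C A rhs τ c₀ :=
  fun γ Γ hf => h γ Γ (hCD γ Γ hf)

end Encoding

end APosteriori

end Summit.Ventures.CertifiedQuantumChemistry
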